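import Literature.Computability.Complexity.GateEliminationXorReconstruction
import Literature.Computability.Complexity.GateEliminationStanding
import Literature.Computability.Complexity.GateEliminationCase7

/-!
# Gate elimination: Case 8.1 of Li–Yang's proof of Theorem 4.1

Case 8 of the one-step claim `LiYang2022_step` (ECCC TR21-023, §4.1, p. 30): `G` is a
topologically minimal ∧-type gate reading a gate `Q` of the cyclic xor-part (after absorbing its
⊕-type ancestors, `GateEliminationAbsorb.lean`) and another node `P`; in Case 8.1 "`Q` computes an
affine function depending on some unprotected variable `x`. By Proposition 2.7, there is a path
from `x` to `Q`. We shall substitute an appropriate constant to `Q` via xor-reconstruction (see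
Section 2.6), such that `G` is trivialized" — the constant substitution to a gate of
`GateEliminationXorReconstruction.lean` (`reroute`, `xor_reconstruction`: `Δμ ≥ α_I`, one
substitution). Proved here:

* `case8_1_1` — **Case 8.1.1**: "`Q` is a `2⁺`-gate. After the xor-construction, it is replaced
  by a constant `b` feeding at least three gates … the three descendants of `b` and at least one
  descendant of `G` are removed by Rule 2 and Rule 3. Hence `ΔΦ ≤ 4`, so that
  `Δμ ≥ 4 - 4α_φ + α_I ≥ δ`": four doomed gates (`G`; the path gate preceding `Q`; the new home
  of a second wire into `Q`; a reader of `G` — a second one, by non-uselessness of `G`, if the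
  first is that second reader of `Q`) and `cascade_doomed`.
* `case8_1_2` — **Case 8.1.2**: "`Q` is a `1`-gate and `P = t` is a variable. By Case 1 and
  Case 7, we can assume that `t` is an unprotected `1`-variable. Hence the xor-reconstruction will
  make both `t` and `x` non-influential, resulting in `Δμ ≥ 2α_I ≥ δ`": after the
  xor-reconstruction `G` (fed by the constant, trivialized) is eliminated by Rule 2 and `t`
  becomes a `0`-variable; `Δμ ≥ 2α_I + (1 - α_φ)`. (The hypothesis "`Q` is a `1`-gate" is not
  used.)
* `case8_1_3` — **Case 8.1.3**: "both `P` and `Q` are `1`-gates. After the xor-reconstruction,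
  `Q` is replaced by a constant `b` of out-degree `2`. We then normalize the circuit such that
  `G`, `P`, and the other two descendants of `b` and `G` are removed … 1. `P` is eliminated by
  Rule 1, it contributes `ΔΦ ≤ 2`. 2. `G` is trivialized and both of its inputs are eliminated,
  it has `ΔΦ ≤ 0`. 3. The other two gates are removed by Rule 2 or Rule 3, they contribute
  `ΔΦ ≤ 2` in total. Hence `Δμ ≥ 4 - 4α_φ + α_I ≥ δ`." Here `P` is a `1`-gate of the xor-part
  (off the path, its only reader being `G`); the second reader of the constant `b` is the path
  gate preceding `Q`, whose reversed equation reads `Q = b` (`reroute_arg_prev_last_zero`); the descendant of `G` exists as `G`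
  is not the output (it is trivialized). (The hypothesis "`Q` is a `1`-gate" is not used.)

## References

* J. Li, T. Yang, *3.1n − o(n) circuit lower bounds for explicit functions*, STOC 2022;
  ECCC TR21-023, §2.6 (xor-reconstruction), §4.1 (Cases 8.1.1, 8.1.2, 8.1.3), Lemma 3.11.
-/

namespace Literature.Computability.Complexity

open Finset

namespace Semicircuit

variable {n : ℕ} {C : Semicircuit n} {f : (Fin n → ZMod 2) → Bool} {R : RdqSource n} {d : ℕ}
  {αφ αI αQ : ℝ} {P : Finset (Fin C.m × Fin C.m)}

/-! ### The local picture after the xor-reconstruction trivializing `G` -/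

section Setup

variable {G Q : Fin C.m} {aQ : Fin 2} {x : Fin n} (p : C.XorPath x Q) (b : Bool)

/-- An ∧-type gate lies off every path of the xor-part. [folklore] -/
theorem XorPath.gate_ne_of_isAndOp (hand : IsAndOp (C.op G)) (j : Fin (p.len + 1)) : p.gate j ≠ G :=
  fun e => C.not_mem_xorPart_of_isAndOp hand (e ▸ p.mem_xorPart j)

/-- After the xor-reconstruction `C[Q := b]`, the gate `G` reading `Q` at position `aQ` reads the
constant `b` there. [cite: LiYang2022, §2.6, §4.1 (Case 8.1)] -/
theorem reroute_arg_reader (hand : IsAndOp (C.op G)) (hGQ : C.arg G aQ = .gate Q) :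
    (C.reroute p b).arg G aQ = .const b :=
  reroute_arg_eq_const_of_eq_gate_last p b (p.gate_ne_of_isAndOp hand) hGQ

/-- The other wire of `G` is rerouted. [folklore] -/
theorem reroute_arg_reader_rev (hand : IsAndOp (C.op G)) (a : Fin 2) :
    (C.reroute p b).arg G a = (C.arg G a).reroute x Q b :=
  reroute_arg_of_not_mem p b (p.gate_ne_of_isAndOp hand) a

/-- The function of `G` is unchanged. [folklore] -/
theorem reroute_op_reader (hand : IsAndOp (C.op G)) : (C.reroute p b).op G = C.op G :=
  reroute_op_of_not_mem p b (p.gate_ne_of_isAndOp hand)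

/-- The live functions of `G` are unchanged. [folklore] -/
theorem liveFn_reroute_reader (hand : IsAndOp (C.op G)) (a : Fin 2) (c : Bool) :
    (C.reroute p b).liveFn G a c = C.liveFn G a c := by
  unfold liveFn
  rw [reroute_op_reader p b hand]

end Setup

/-! ### Case 8.1.2 -/

/-- **Case 8.1.2 of Li–Yang's proof of Theorem 4.1**: `G` is an ∧-type gate reading at `aQ` a
gate `Q` of the xor-part which depends on the unprotected variable `x` (with a path from `x` to
`Q`), and at the other position an unprotected `1`-variable `t ≠ x`. The xor-reconstruction
`Q := b` trivializing `G` (`Δμ ≥ α_I`, `x` no longer influential) is followed by Rule 2 on `G`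
(`Δμ ≥ 1 - α_φ`), after which `t` is a `0`-variable (`Δμ ≥ α_I`): `Δμ ≥ 2α_I + 1 - α_φ ≥ δ`,
one substitution. [cite: LiYang2022, §4.1 (Case 8.1.2)] -/
theorem case8_1_2 (hf : IsAffineDisperser f d) (hd : 2 * d + 2 < R.dim) (hF : C.Fair)
    (hC : C.ComputesRestr f R) (hP : C.IsPacking P) (hφ : 0 ≤ αφ) (hφ1 : αφ ≤ 1) (hI : 0 ≤ αI) (αQ : ℝ)
    {G Q : Fin C.m} {aQ : Fin 2} (hand : IsAndOp (C.op G)) (hGQ : C.arg G aQ = .gate Q)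
    {x : Fin n} (p : C.XorPath x Q) (hdep : C.DependsOn hF Q x) (hxp : ¬ R.Protected x)
    {t : Fin n} (hGt : C.arg G aQ.rev = .var t) (ht1 : C.fanout (.var t) = 1) (htp : ¬ R.Protected t)
    (htx : t ≠ x) :
    C.StepBranch2 f R αφ αI αQ P := by
  classical
  obtain ⟨b, hb⟩ := exists_trivializing hand aQ
  obtain ⟨P', hF', hC', hP', hdim, -, hprot, hμ'⟩ := C.xor_reconstruction hF hC hP p hdep hxp b hφ hI αQ
  have hGoff := p.gate_ne_of_isAndOp hand
  have h₀ : (C.reroute p b).arg G aQ = .const b := reroute_arg_reader p b hand hGQ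
  have hGt' : (C.reroute p b).arg G aQ.rev = .var t := by
    rw [reroute_arg_reader_rev p b hand, hGt, Node.reroute_var_of_ne x Q b htx]
  have htriv' : (C.reroute p b).liveFn G aQ b false = (C.reroute p b).liveFn G aQ b true := by
    rw [liveFn_reroute_reader p b hand]; exact hb
  have hd' : 2 * d + 2 ≤ (C.rerouteSource hF b hC p hxp).dim := by omega
  have hout' : (C.reroute p b).out ≠ .gate G := out_ne_of_trivialized hf (by omega) hF' hC' h₀ htriv'
  -- Rule 2 on `G`
  let E := elimDataWTriv hF' hC' hP' h₀ htriv' hout' hφ hI αQ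
  have hrepl : E.repl = .const ((C.reroute p b).liveFn G aQ b false) := rfl
  -- `t` becomes a `0`-variable
  have hft' : (C.reroute p b).fanout (.var t) = 1 := by
    rw [fanout_reroute_of_generic p b (v := .var t) (fun e => htx (Node.var.inj e)) (by simp) (by simp)]
    exact ht1
  have hft : E.C'.fanout (.var t) = 0 := by
    have h1 := E.fanout_var_add (i := t) (by rw [hrepl]; exact fun h => by cases h)
    have h2 : 1 ≤ (univ.filter fun a : Fin 2 => (C.reroute p b).arg G a = .var t).card :=
      card_pos.mpr ⟨aQ.rev, mem_filter.mpr ⟨mem_univ _, hGt'⟩⟩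
    omega
  -- accounting of influential inputs: `t` is lost on top of the generic inclusion
  have htinf' : t ∈ (C.reroute p b).influential (C.rerouteSource hF b hC p hxp) := by
    unfold influential; exact mem_filter.mpr ⟨mem_univ _, Or.inl (by omega)⟩
  have htinf : t ∉ E.C'.influential (C.rerouteSource hF b hC p hxp) := by
    unfold influential
    rw [mem_filter, not_and]
    intro _ h
    rcases h with h | h
    · omega
    · exact htp ((hprot t).mp h)
  have hcard : (E.C'.influential (C.rerouteSource hF b hC p hxp)).card + 1 ≤
      ((C.reroute p b).influential (C.rerouteSource hF b hC p hxp)).card := by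
    have hsub : E.C'.influential (C.rerouteSource hF b hC p hxp) ⊆
        ((C.reroute p b).influential (C.rerouteSource hF b hC p hxp)).erase t := fun j hj =>
      mem_erase.mpr ⟨fun e => htinf (e ▸ hj), E.influential_subset _ hj⟩
    have h1 := card_le_card hsub
    rw [card_erase_of_mem htinf'] at h1
    have h2 := card_pos.mpr ⟨t, htinf'⟩
    omega
  have hc : ((E.C'.influential (C.rerouteSource hF b hC p hxp)).card : ℝ) + 1 ≤
      ((C.reroute p b).influential (C.rerouteSource hF b hC p hxp)).card := by exact_mod_cast hcard
  have hμE : E.C'.measure αφ αI αQ E.P' (C.rerouteSource hF b hC p hxp) ≤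
      (C.reroute p b).measure αφ αI αQ P' (C.rerouteSource hF b hC p hxp) - 1 - αI + αφ := by
    have hm : (E.C'.m : ℝ) + 1 = (C.reroute p b).m := by exact_mod_cast E.m_add_one
    have hpot := E.potential_le
    unfold measure
    nlinarith [mul_le_mul_of_nonneg_left hpot hφ]
  refine ⟨1, le_rfl, by norm_num, E.C', C.rerouteSource hF b hC p hxp, E.P', E.fair, E.computes, E.packing, hdim, ?_⟩
  have hδ := liYangDelta_le_four_thirds αφ αI αQ
  simp only [Nat.cast_one, mul_one]
  nlinarith

/-! ### Case 8.1.3 -/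

/-- **Case 8.1.3 of Li–Yang's proof of Theorem 4.1**: in a pre-normalized fair semicircuit
computing `f|_R` (`f` an affine disperser for dimension `d`, `dim R > 2d + 2`), `G` is an ∧-type
gate reading at `aQ` a gate `Q` of the xor-part which depends on the unprotected variable `x`
(with a path from `x` to `Q`), and at the other position a `1`-gate `P` of the xor-part. The
xor-reconstruction `Q := b` trivializing `G` (`Δμ ≥ α_I`) is followed by four eliminations: `G`
(Rule 2, `ΔΦ ≤ 0`: its inputs are a constant and the ⊕-type gate `P`), `P` (now a `0`-gate,
Rule 1, `ΔΦ ≤ 2`), the path gate preceding `Q` (fed by the constant `b`) and the reader of `G`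
(fed by the constant `G` computes), `ΔΦ ≤ 1` each: `Δμ ≥ 4 - 4α_φ + α_I ≥ δ`, one
substitution. [cite: LiYang2022, §4.1 (Case 8.1.3)] -/
theorem case8_1_3 (hf : IsAffineDisperser f d) (hd : 2 * d + 2 < R.dim) (hF : C.Fair)
    (hC : C.ComputesRestr f R) (hP : C.IsPacking P) (hφ : 0 ≤ αφ) (hI : 0 ≤ αI) (αQ : ℝ)
    (hN : C.PreNormalized)
    {G Q : Fin C.m} {aQ : Fin 2} (hand : IsAndOp (C.op G)) (hGQ : C.arg G aQ = .gate Q)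
    {x : Fin n} (p : C.XorPath x Q) (hdep : C.DependsOn hF Q x) (hxp : ¬ R.Protected x)
    {Pg : Fin C.m} (hGP : C.arg G aQ.rev = .gate Pg) (hPK : Pg ∈ C.xorPart) (hP1 : C.fanout (.gate Pg) = 1) :
    C.StepBranch2 f R αφ αI αQ P := by
  classical
  have hGK : G ∉ C.xorPart := C.not_mem_xorPart_of_isAndOp hand
  have hPG : Pg ≠ G := fun e => hGK (e ▸ hPK)
  have hPQ : Pg ≠ Q := by
    intro e
    apply hN.arg_zero_ne_arg_one G
    obtain rfl | rfl : aQ = 0 ∨ aQ = 1 := by fin_cases aQ <;> simp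
    · exact hGQ.trans ((congrArg Node.gate e).symm.trans hGP.symm)
    · exact hGP.trans ((congrArg Node.gate e).trans hGQ.symm)
  have hGoff := p.gate_ne_of_isAndOp hand
  -- `P` is off the path: a path gate other than `Q` is read by the next path gate, not by `G` only
  have hPoff : ∀ j, p.gate j ≠ Pg := by
    intro j e
    induction j using Fin.lastCases with
    | last => exact hPQ (e.symm.trans p.gate_last)
    | cast j =>
      have hread := p.arg_succ j
      rw [e] at hread
      exact arg_ne_gate_of_ne hGP hP1 (p.gate j.succ) (hGoff _) _ hread
  obtain ⟨b, hb⟩ := exists_trivializing hand aQ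
  obtain ⟨P', hF', hC', hP', hdim, -, -, hμ'⟩ := C.xor_reconstruction hF hC hP p hdep hxp b hφ hI αQ
  have h₀ : (C.reroute p b).arg G aQ = .const b := reroute_arg_reader p b hand hGQ
  have hGP' : (C.reroute p b).arg G aQ.rev = .gate Pg := by
    rw [reroute_arg_reader_rev p b hand, hGP, Node.reroute_gate_of_ne x Q b hPQ]
  have htriv' : (C.reroute p b).liveFn G aQ b false = (C.reroute p b).liveFn G aQ b true := by
    rw [liveFn_reroute_reader p b hand]; exact hb
  have hd' : 2 * d + 2 ≤ (C.rerouteSource hF b hC p hxp).dim := by omega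
  have hout' : (C.reroute p b).out ≠ .gate G := out_ne_of_trivialized hf (by omega) hF' hC' h₀ htriv'
  -- `G` is not the output of `C` either, so it has a reader `H`, a gate of the acyclic part
  have houtC : C.out ≠ .gate G := by
    intro h
    apply hout'
    rw [reroute_out, h, Node.reroute_gate_of_ne x Q b]
    exact fun e => hGK (e ▸ p.last_mem_xorPart)
  obtain ⟨H, aH, hHG⟩ : ∃ (H : Fin C.m) (aH : Fin 2), C.arg H aH = .gate G := by
    by_contra hno
    push Not at hno
    exact houtC (hN.out_of_fanout_eq_zero G ((fanout_eq_zero_iff C _).mpr hno))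
  have hHK : H ∉ C.xorPart := fun hHK => hGK (C.mem_of_arg_eq H hHK aH G hHG)
  have hHoff : ∀ j, p.gate j ≠ H := fun j e => hHK (e ▸ p.mem_xorPart j)
  have hHG' : (C.reroute p b).arg H aH = .gate G := by
    rw [reroute_arg_of_not_mem p b hHoff, hHG, Node.reroute_gate_of_ne x Q b]
    exact fun e => hGK (e ▸ p.last_mem_xorPart)
  have hHGne : H ≠ G := fun e => C.arg_ne_self_of_not_mem hGK aH (e ▸ hHG)
  have hHP : H ≠ Pg := fun e => hHK (e ▸ hPK)
  -- the path gate preceding `Q` reads the constant `b`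
  set k₀ := p.gate (p.prev (Fin.last p.len)) with hk₀
  have hk₀b : (C.reroute p b).arg k₀ 0 = .const b := reroute_arg_prev_last_zero p b
  have hk₀G : k₀ ≠ G := hGoff _
  have hk₀P : k₀ ≠ Pg := hPoff _
  have hk₀H : k₀ ≠ H := hHoff _
  -- step 1: eliminate `G` (trivialized), introducing no troubled gate
  let E₁ := elimDataWTriv hF' hC' hP' h₀ htriv' hout' hφ hI αQ
  have hrepl : E₁.repl = .const ((C.reroute p b).liveFn G aQ b false) := rfl
  have hnonew : ∀ k', E₁.C'.Troubled k' → ¬ (C.reroute p b).Troubled (E₁.ι k') → False := by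
    intro k' hT' hT
    obtain ⟨a, ha⟩ := E₁.causedBy_of_new_troubled k' hT' hT
    rcases fin2_eq_or_eq_rev aQ a with rfl | rfl
    · rw [h₀] at ha; exact not_causedBy_const ha
    · rw [hGP'] at ha
      rcases ha with ha | ⟨z, hz, -⟩
      · -- `k'` is `P`, a ⊕-type gate
        have hιP : E₁.ι k' = Pg := (Node.gate.inj ha).symm
        obtain ⟨hand', -⟩ := hT'
        rw [E₁.isAndOp_iff, hιP, reroute_op_of_not_mem p b hPoff] at hand'
        exact not_isAndOp_of_isXorOp (C.isXorOp_of_mem Pg hPK) hand'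
      · cases hz
  obtain ⟨P₁, hP₁', hpot₁⟩ := E₁.exists_packing_of_cover hP' ∅ ∅ (fun k' hT' hT => (hnonew k' hT' hT).elim)
    (Or.inl (by simp)) (Or.inl (by simp))
  simp only [if_true, Nat.cast_zero, add_zero] at hpot₁
  -- `P` in the new circuit: a `0`-gate, not the output
  obtain ⟨kP, hkP⟩ := E₁.ι_surj Pg hPG
  have hP0 : E₁.C'.fanout (.gate kP) = 0 := by
    have h1 := E₁.fanout_gate_add (k' := kP) (by rw [hrepl]; exact fun h => by cases h)
    rw [hkP] at h1
    have h2 : (C.reroute p b).fanout (.gate Pg) = 1 := by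
      rw [fanout_reroute_of_generic p b (v := .gate Pg) (by simp) (fun t e => hPoff t (Node.gate.inj e).symm) (by simp)]
      exact hP1
    have h3 : 1 ≤ (univ.filter fun a : Fin 2 => (C.reroute p b).arg G a = .gate Pg).card :=
      card_pos.mpr ⟨aQ.rev, mem_filter.mpr ⟨mem_univ _, hGP'⟩⟩
    omega
  have hout₂ : E₁.C'.out ≠ .gate kP := by
    intro h
    have := E₁.out_eq
    rw [h, if_neg hout'] at this
    change Node.gate (E₁.ι kP) = (C.reroute p b).out at this
    rw [hkP, reroute_out] at this
    -- `C.out` would be `P`, a gate of the xor-part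
    have hCout : C.out = .gate Pg := by
      cases hco : C.out with
      | const c => rw [hco] at this; cases this
      | var i =>
        rw [hco] at this
        by_cases hi : i = x
        · rw [hi, Node.reroute_var_self] at this; cases this; exact absurd rfl hPQ
        · rw [Node.reroute_var_of_ne x Q b hi] at this; cases this
      | gate k =>
        rw [hco] at this
        by_cases hk : k = Q
        · rw [hk, Node.reroute_gate_self] at this; cases this
        · rw [Node.reroute_gate_of_ne x Q b hk] at this; cases this; rfl
    exact out_ne_gate_of_mem_xorPart hf (by omega) hF hC hPK hCout
  -- step 2: delete the `0`-gate `P` (Rule 1, `ΔΦ ≤ 2`)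
  have hno : ∀ k a, E₁.C'.arg k a ≠ .gate kP := (fanout_eq_zero_iff _ _).mp hP0
  let ε₂ := E₁.C'.skipEquiv kP
  let C₂ := E₁.C'.removeGate kP ε₂
  have hF₂ : C₂.Fair := E₁.fair.removeGate ε₂ hno
  have hC₂ : C₂.ComputesRestr f (C.rerouteSource hF b hC p hxp) := E₁.computes.removeGate ε₂ E₁.fair hno hout₂
  obtain ⟨P₂, hP₂, hpot₂⟩ := E₁.C'.exists_packing_removeGate_le kP ε₂ hno hP₁'
  have hpot₂' : C₂.potential P₂ ≤ E₁.C'.potential P₁ + 2 := by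
    refine hpot₂.trans ?_; split_ifs <;> norm_num
  -- step 3: the path gate preceding `Q` and the reader `H` of `G` are fed by constants in `C₂`
  obtain ⟨kk, hkk⟩ := E₁.ι_surj k₀ hk₀G
  obtain ⟨kH, hkH⟩ := E₁.ι_surj H hHGne
  have hkk' : ∃ a b', E₁.C'.arg kk a = .const b' := E₁.constFed kk ⟨0, b, by rw [hkk]; exact hk₀b⟩
  have hkH' : ∃ a b', E₁.C'.arg kH a = .const b' :=
    E₁.trivReaders ⟨aQ, b, h₀, htriv'⟩ kH ⟨aH, by rw [hkH]; exact hHG'⟩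
  have hkkP : kk ≠ kP := fun h => hk₀P (by rw [← hkk, ← hkP, h])
  have hkHP : kH ≠ kP := fun h => hHP (by rw [← hkH, ← hkP, h])
  have hkkH : kk ≠ kH := fun h => hk₀H (by rw [← hkk, ← hkH, h])
  have hcount : 2 ≤ C₂.constFedCount := by
    unfold constFedCount
    have hmem : ∀ {k : Fin E₁.C'.m} (hk : k ≠ kP), (∃ (a : Fin 2) (b' : Bool), E₁.C'.arg k a = .const b') →
        ε₂.symm ⟨k, hk⟩ ∈ univ.filter fun k => ∃ a b', C₂.arg k a = .const b' := by
      rintro k hk ⟨a, b', h⟩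
      refine mem_filter.mpr ⟨mem_univ _, a, b', ?_⟩
      show (E₁.C'.arg (ε₂ (ε₂.symm ⟨k, hk⟩)) a).skip kP ε₂ = .const b'
      rw [Equiv.apply_symm_apply ε₂]
      show (E₁.C'.arg k a).skip kP ε₂ = .const b'
      rw [h]; rfl
    have hsub : ({ε₂.symm ⟨kk, hkkP⟩, ε₂.symm ⟨kH, hkHP⟩} : Finset _) ⊆
        univ.filter fun k => ∃ a b', C₂.arg k a = .const b' := by
      intro k hk
      rw [mem_insert, mem_singleton] at hk
      rcases hk with rfl | rfl
      · exact hmem hkkP hkk'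
      · exact hmem hkHP hkH'
    have hne : ε₂.symm ⟨kk, hkkP⟩ ≠ ε₂.symm ⟨kH, hkHP⟩ := fun h => hkkH (by
      have := congrArg Subtype.val (ε₂.symm.injective h); exact this)
    have := card_le_card hsub
    rwa [card_pair hne] at this
  obtain ⟨D', P'', hFD, hCD, hPD, hm', hμD⟩ := cascade hf hd' hφ hI αQ 2 C₂ P₂ hF₂ hC₂ hP₂ hcount
  -- accounting
  refine ⟨1, le_rfl, by norm_num, D', C.rerouteSource hF b hC p hxp, P'', hFD, hCD, hPD, hdim, ?_⟩
  have hδ := liYangDelta_le_case3 αφ αI αQ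
  have hinf₂ : ((C₂.influential (C.rerouteSource hF b hC p hxp)).card : ℝ) ≤
      ((C.reroute p b).influential (C.rerouteSource hF b hC p hxp)).card := by
    have h1 := E₁.C'.influential_removeGate_subset kP ε₂ hno (C.rerouteSource hF b hC p hxp)
    have h2 := E₁.influential_subset (C.rerouteSource hF b hC p hxp)
    exact_mod_cast card_le_card (h1.trans h2)
  have hinf₁ : ((E₁.C'.influential (C.rerouteSource hF b hC p hxp)).card : ℝ) ≤
      ((C.reroute p b).influential (C.rerouteSource hF b hC p hxp)).card := by
    exact_mod_cast card_le_card (E₁.influential_subset _)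
  have hm₁ := E₁.m_add_one
  have hm₂ := E₁.C'.removeGate_m_add_one kP ε₂
  have hmC₂ : (C₂.m : ℝ) + 2 = (C.reroute p b).m := by
    have : C₂.m + 2 = (C.reroute p b).m := by change (E₁.C'.m - 1) + 2 = (C.reroute p b).m; omega
    exact_mod_cast this
  have hμ₂ : C₂.measure αφ αI αQ P₂ (C.rerouteSource hF b hC p hxp) ≤
      (C.reroute p b).measure αφ αI αQ P' (C.rerouteSource hF b hC p hxp) - 2 + 2 * αφ := by
    unfold measure
    nlinarith [mul_le_mul_of_nonneg_left hinf₂ hI, mul_le_mul_of_nonneg_left hpot₂' hφ,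
      mul_le_mul_of_nonneg_left hpot₁ hφ]
  push_cast at hμD
  simp only [Nat.cast_one, mul_one]
  linarith

/-! ### Case 8.1.1 -/

/-- Two distinct readers of a node with at least two wires into it, in a circuit without
coinciding wires. [folklore] -/
theorem exists_two_readers {D : Semicircuit n} (hN : ∀ k, D.arg k 0 ≠ D.arg k 1) {v : Node n D.m}
    (h2 : 2 ≤ D.fanout v) : ∃ (k₁ k₂ : Fin D.m) (a₁ a₂ : Fin 2), k₁ ≠ k₂ ∧ D.arg k₁ a₁ = v ∧ D.arg k₂ a₂ = v := by
  classical
  rw [D.fanout_eq_card_readers hN v] at h2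
  obtain ⟨k₁, k₂, hk₁, hk₂, hne⟩ := one_lt_card_iff.mp h2
  obtain ⟨a₁, ha₁⟩ := (mem_filter.mp hk₁).2
  obtain ⟨a₂, ha₂⟩ := (mem_filter.mp hk₂).2
  exact ⟨k₁, k₂, a₁, a₂, hne, ha₁, ha₂⟩

/-- Given one reader of a node with at least two wires into it, another reader (no coinciding
wires). [folklore] -/
theorem exists_other_reader {D : Semicircuit n} (hN : ∀ k, D.arg k 0 ≠ D.arg k 1) {v : Node n D.m}
    (h2 : 2 ≤ D.fanout v) (k : Fin D.m) : ∃ (k' : Fin D.m) (a' : Fin 2), k' ≠ k ∧ D.arg k' a' = v := by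
  obtain ⟨k₁, k₂, a₁, a₂, hne, h₁, h₂⟩ := exists_two_readers hN h2
  by_cases hk : k₁ = k
  · exact ⟨k₂, a₂, fun e => hne (hk.trans e.symm), h₂⟩
  · exact ⟨k₁, a₁, hk, h₁⟩

/-- **Case 8.1.1 of Li–Yang's proof of Theorem 4.1**: "Assume that `Q` is a `2⁺`-gate. After the
xor-construction, it is replaced by a constant `b` feeding at least three gates … We then normalize
the circuit such that the three descendants of `b` and at least one descendant of `G` are removed
by Rule 2 and Rule 3. Hence `ΔΦ ≤ 4`, so that `Δμ ≥ 4 - 4α_φ + α_I ≥ δ`." Here, in a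
pre-normalized fair semicircuit computing `f|_R` (`dim R > 2d + 2`): `G` ∧-type, not useless,
reading at `aQ` a `2⁺`-gate `Q` of the xor-part not reading itself which depends on the
unprotected `x` (path from `x` to `Q`). After `Q := b` (trivializing `G`, `Δμ ≥ α_I`) four gates
are doomed — `G`, the path gate preceding `Q` (its reversed equation reads `b`), the new home of
a second wire into `Q` (the reader itself off the path, the preceding path gate if on it), and a
reader of `G` (a second one if the first is that second reader of `Q`, by non-uselessness) — and
are eliminated by Rules 2/3 (`cascade_doomed`): `Δμ ≥ α_I + 4(1 - α_φ) ≥ δ`, one substitution.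
[cite: LiYang2022, §4.1 (Case 8.1.1)] -/
theorem case8_1_1 (hf : IsAffineDisperser f d) (hd : 2 * d + 2 < R.dim) (hF : C.Fair)
    (hC : C.ComputesRestr f R) (hP : C.IsPacking P) (hφ : 0 ≤ αφ) (hI : 0 ≤ αI) (αQ : ℝ)
    (hN : C.PreNormalized)
    {G Q : Fin C.m} {aQ : Fin 2} (hand : IsAndOp (C.op G)) (hGQ : C.arg G aQ = .gate Q) (hGnu : ¬ C.Useless G)
    {x : Fin n} (p : C.XorPath x Q) (hdep : C.DependsOn hF Q x) (hxp : ¬ R.Protected x)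
    (hQ2 : 2 ≤ C.fanout (.gate Q)) (hQself : ∀ a, C.arg Q a ≠ .gate Q) :
    C.StepBranch2 f R αφ αI αQ P := by
  classical
  have hGK : G ∉ C.xorPart := C.not_mem_xorPart_of_isAndOp hand
  have hGQne : G ≠ Q := fun e => hGK (e ▸ p.last_mem_xorPart)
  have hGoff := p.gate_ne_of_isAndOp hand
  obtain ⟨b, hb⟩ := exists_trivializing hand aQ
  obtain ⟨P', hF', hC', hP', hdim, -, -, hμ'⟩ := C.xor_reconstruction hF hC hP p hdep hxp b hφ hI αQ
  have h₀ : (C.reroute p b).arg G aQ = .const b := reroute_arg_reader p b hand hGQ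
  have htriv' : (C.reroute p b).liveFn G aQ b false = (C.reroute p b).liveFn G aQ b true := by
    rw [liveFn_reroute_reader p b hand]; exact hb
  have hd' : 2 * d + 2 ≤ (C.rerouteSource hF b hC p hxp).dim := by omega
  have hout' : (C.reroute p b).out ≠ .gate G := out_ne_of_trivialized hf (by omega) hF' hC' h₀ htriv'
  have hsyn : (C.reroute p b).SynVal (.gate G) ((C.reroute p b).liveFn G aQ b false) :=
    SynVal.of_trivialized _ h₀ htriv'
  -- `G` is not the output of `C`, so it has readers, gates of the acyclic part off the path
  have houtC : C.out ≠ .gate G := by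
    intro h
    apply hout'
    rw [reroute_out, h, Node.reroute_gate_of_ne x Q b hGQne]
  have hreaderG : ∀ {H : Fin C.m} {aH : Fin 2}, C.arg H aH = .gate G →
      (∀ j, p.gate j ≠ H) ∧ (C.reroute p b).arg H aH = .gate G ∧ H ∈ (C.reroute p b).doomed ∧ H ≠ G := by
    intro H aH hHG
    have hHK : H ∉ C.xorPart := fun hHK => hGK (C.mem_of_arg_eq H hHK aH G hHG)
    have hHoff : ∀ j, p.gate j ≠ H := fun j e => hHK (e ▸ p.mem_xorPart j)
    have hHG' : (C.reroute p b).arg H aH = .gate G := by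
      rw [reroute_arg_of_not_mem p b hHoff, hHG, Node.reroute_gate_of_ne x Q b hGQne]
    exact ⟨hHoff, hHG', mem_doomed_of_reads _ hHG' hsyn, fun e => C.arg_ne_self_of_not_mem hGK aH (e ▸ hHG)⟩
  obtain ⟨H, aH, hHG⟩ : ∃ (H : Fin C.m) (aH : Fin 2), C.arg H aH = .gate G := by
    by_contra hno
    push Not at hno
    exact houtC (hN.out_of_fanout_eq_zero G ((fanout_eq_zero_iff C _).mpr hno))
  obtain ⟨hHoff, -, hHdoom, hHG'⟩ := hreaderG hHG
  -- the path gate preceding `Q`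
  have hk₀b : (C.reroute p b).arg (p.gate (p.prev (Fin.last p.len))) 0 = .const b := reroute_arg_prev_last_zero p b
  have hk₀doom : p.gate (p.prev (Fin.last p.len)) ∈ (C.reroute p b).doomed := mem_doomed_of_const _ hk₀b
  have hGdoom : G ∈ (C.reroute p b).doomed := mem_doomed_of_const _ h₀
  -- a second reader `A ≠ G` of `Q`, and the new home of its wire
  obtain ⟨A, aA, hAG, hAQ⟩ := exists_other_reader hN.arg_zero_ne_arg_one hQ2 G
  have hAQne : A ≠ Q := fun e => hQself aA (e ▸ hAQ)
  -- four distinct doomed gates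
  have h4 : 4 ≤ (C.reroute p b).doomed.card := by
    by_cases hAoff : ∀ j, p.gate j ≠ A
    · -- `A` off the path reads `b` itself
      have hAb : (C.reroute p b).arg A aA = .const b := reroute_arg_eq_const_of_eq_gate_last p b hAoff hAQ
      have hAdoom : A ∈ (C.reroute p b).doomed := mem_doomed_of_const _ hAb
      have hAk₀ : A ≠ p.gate (p.prev (Fin.last p.len)) := fun e => hAoff _ e.symm
      by_cases hHA : H = A
      · -- `A` reads `G` and `Q`: as `G` is not useless, `G` has a second reader
        subst hHA
        have hG2 : 2 ≤ C.fanout (.gate G) := by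
          by_contra hlt
          have h1 : C.fanout (.gate G) = 1 := by
            have := fanout_pos_of_arg_eq hHG; omega
          refine hGnu ⟨h1, H, aH, aQ, hHG'.symm, hHG, ?_⟩
          -- the other wire of the reader is its wire to `Q`
          have haa : aA = aH.rev := by
            rcases fin2_eq_or_eq_rev aH aA with e | e
            · rw [e] at hAQ; rw [hAQ] at hHG; cases hHG; exact absurd rfl hGQne.symm
            · exact e
          rw [← haa, hAQ, hGQ]
        obtain ⟨H₂, a₂, hH₂, hH₂G⟩ := exists_other_reader hN.arg_zero_ne_arg_one hG2 H
        obtain ⟨hH₂off, -, hH₂doom, hH₂G'⟩ := hreaderG hH₂G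
        have hH₂k₀ : H₂ ≠ p.gate (p.prev (Fin.last p.len)) := fun e => hH₂off _ e.symm
        have hsub : ({G, p.gate (p.prev (Fin.last p.len)), H, H₂} : Finset (Fin C.m)) ⊆ (C.reroute p b).doomed := by
          intro k hk
          simp only [mem_insert, mem_singleton] at hk
          rcases hk with rfl | rfl | rfl | rfl
          · exact hGdoom
          · exact hk₀doom
          · exact hAdoom
          · exact hH₂doom
        refine le_trans ?_ (card_le_card hsub)
        rw [card_insert_of_notMem, card_insert_of_notMem, card_pair hH₂.symm]
        · simp only [mem_insert, mem_singleton, not_or]; exact ⟨fun e => hAk₀ e.symm, hH₂k₀.symm⟩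
        · simp only [mem_insert, mem_singleton, not_or]; exact ⟨hGoff _ |>.symm, hAG.symm, hH₂G'.symm⟩
      · have hsub : ({G, p.gate (p.prev (Fin.last p.len)), A, H} : Finset (Fin C.m)) ⊆ (C.reroute p b).doomed := by
          intro k hk
          simp only [mem_insert, mem_singleton] at hk
          rcases hk with rfl | rfl | rfl | rfl
          · exact hGdoom
          · exact hk₀doom
          · exact hAdoom
          · exact hHdoom
        refine le_trans ?_ (card_le_card hsub)
        have hHk₀ : H ≠ p.gate (p.prev (Fin.last p.len)) := fun e => hHoff _ e.symm
        rw [card_insert_of_notMem, card_insert_of_notMem, card_pair (Ne.symm hHA)]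
        · simp only [mem_insert, mem_singleton, not_or]; exact ⟨fun e => hAk₀ e.symm, hHk₀.symm⟩
        · simp only [mem_insert, mem_singleton, not_or]; exact ⟨hGoff _ |>.symm, hAG.symm, hHG'.symm⟩
    · -- `A = p.gate t` on the path reads `Q` as its other input; the preceding slot inherits that wire
      push Not at hAoff
      obtain ⟨t, rfl⟩ := hAoff
      have hother : p.other t = .gate Q := by
        rcases p.arg_eq_src_or_other t aA with ⟨-, he⟩ | ⟨-, he⟩
        · exact absurd (he.symm.trans hAQ) (p.src_ne_gate_last t)
        · exact he.symm.trans hAQ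
      have ht : t ≠ Fin.last p.len := fun e => hAQne (by rw [e, p.gate_last])
      set A' := p.gate (p.prev t) with hA'
      have hA'b : (C.reroute p b).arg A' 1 = .const b := by
        rw [hA', reroute_arg_gate_one, XorPath.next_prev, hother, Node.reroute_gate_self]
      have hA'doom : A' ∈ (C.reroute p b).doomed := mem_doomed_of_const _ hA'b
      have hA'k₀ : A' ≠ p.gate (p.prev (Fin.last p.len)) := by
        intro e
        have := p.injective e
        apply ht
        have h1 := congrArg p.next this
        rwa [XorPath.next_prev, XorPath.next_prev] at h1
      have hA'G : A' ≠ G := hGoff _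
      have hHA' : H ≠ A' := fun e => hHoff _ e.symm
      have hHk₀ : H ≠ p.gate (p.prev (Fin.last p.len)) := fun e => hHoff _ e.symm
      have hsub : ({G, p.gate (p.prev (Fin.last p.len)), A', H} : Finset (Fin C.m)) ⊆ (C.reroute p b).doomed := by
        intro k hk
        simp only [mem_insert, mem_singleton] at hk
        rcases hk with rfl | rfl | rfl | rfl
        · exact hGdoom
        · exact hk₀doom
        · exact hA'doom
        · exact hHdoom
      refine le_trans ?_ (card_le_card hsub)
      rw [card_insert_of_notMem, card_insert_of_notMem, card_pair hHA'.symm]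
      · simp only [mem_insert, mem_singleton, not_or]; exact ⟨hA'k₀.symm, hHk₀.symm⟩
      · simp only [mem_insert, mem_singleton, not_or]; exact ⟨hGoff _ |>.symm, hA'G.symm, hHG'.symm⟩
  obtain ⟨D', P'', hFD, hCD, hPD, hm', hμD⟩ :=
    cascade_doomed hf hd' hφ hI αQ 4 (C.reroute p b) P' hF' hC' hP' h4
  refine ⟨1, le_rfl, by norm_num, D', C.rerouteSource hF b hC p hxp, P'', hFD, hCD, hPD, hdim, ?_⟩
  have hδ := liYangDelta_le_case3 αφ αI αQ
  push_cast at hμD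
  simp only [Nat.cast_one, mul_one]
  linarith

end Semicircuit

end Literature.Computability.Complexity
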